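import Literature.MathematicalPhysics.QuantumManyBody.BoseGasFreeDirichletBEC
import Literature.MathematicalPhysics.QuantumManyBody.BoseGasCutoffStateOccupation
import Literature.MathematicalPhysics.QuantumManyBody.TorusPoincareInequality
import Literature.MathematicalPhysics.QuantumManyBody.PeriodicBoseGasFourier
import Literature.Analysis.FluidPDE.PoincareBall
import HarnessLib

/-!
# Route BECBathMassLiouville — `FrozenBathNoBEC` (stmt-AtomisticToContinuum-13803), helper file 1:
# the local (one-cell) Neumann bound with a potential

Elementary real-variable input for the quenched one-body problem `h_Y = -Δ + ∑ⱼ v^per(x - Yⱼ)` on the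
torus: on a translated cube `Q = a + [0,b)³` carrying a bounded potential `w ≤ K` with
`K ≤ 2π²/(3b²)`,

  `(∫_Q w) · ∫_Q |f|² ≤ 4 b³ · ∫_Q (|∇f|² + w |f|²)`

for every `C¹` function `f` (`local_mass_bound`): a near-zero-energy state cannot put mass on a cell
that carries potential. Proof: Neumann–Poincaré on `Q` (`local_poincare_cellShift`, gap `π²/b²`) for
`f - ⟨f⟩_Q`, and the two pointwise inequalities `|f|² ≤ 2|c|² + 2|f-c|²`, `|c|² w ≤ 2w|f|² + 2K|f-c|²`.
Also: the potential integral `∫_Q min(v(|x-y|), K)` of a scatterer `y` whose range ball lies in `Q`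
is the full `W₀(K) = ∫ min(v(|z|), K) dz`, which is positive as soon as the scattering length is
positive, and finite for finite range.

References: LSSY2005 (after (2.50), the Neumann gap of a cube); Sznitman 1998 (Lifshitz-tail
localisation heuristics behind the item).
-/

noncomputable section

namespace Summit.AtomisticToContinuum.BoseEinsteinCondensation.Theorems.FrozenBath

open MeasureTheory Metric Set Filter
open scoped ENNReal NNReal
open Literature.MathematicalPhysics.QuantumManyBody.BoseGas

variable {b : ℝ}

/-- `‖u‖² ≤ 2‖c‖² + 2‖u - c‖²` in `ℝ≥0∞`. [folklore] -/
theorem nnnorm_sq_le_two_mul (u c : ℂ) :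
    ((‖u‖₊ : ℝ≥0∞) ^ 2) ≤ 2 * (‖c‖₊ : ℝ≥0∞) ^ 2 + 2 * (‖u - c‖₊ : ℝ≥0∞) ^ 2 :=
  calc ((‖u‖₊ : ℝ≥0∞) ^ 2) ≤ ((‖c‖₊ : ℝ≥0∞) + ‖u - c‖₊) ^ 2 := by
        gcongr
        exact_mod_cast nnnorm_le_insert' u c
    _ ≤ _ := Literature.Analysis.FluidPDE.PoincareBall.add_sq_le_two_mul_sq_add _ _

/-- `‖c‖² ≤ 2‖u‖² + 2‖u - c‖²` in `ℝ≥0∞`. [folklore] -/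
theorem nnnorm_sq_le_two_mul' (u c : ℂ) :
    ((‖c‖₊ : ℝ≥0∞) ^ 2) ≤ 2 * (‖u‖₊ : ℝ≥0∞) ^ 2 + 2 * (‖u - c‖₊ : ℝ≥0∞) ^ 2 :=
  calc ((‖c‖₊ : ℝ≥0∞) ^ 2) ≤ ((‖u‖₊ : ℝ≥0∞) + ‖u - c‖₊) ^ 2 := by
        gcongr
        exact_mod_cast nnnorm_le_insert u c
    _ ≤ _ := Literature.Analysis.FluidPDE.PoincareBall.add_sq_le_two_mul_sq_add _ _

/-- **Neumann–Poincaré on a translated cube, mean-deviation form**: for `f ∈ C¹(ℝ³; ℂ)` and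
`Q = a + [0,b)³`, `(π/b)² ∫_Q |f - ⟨f⟩_Q|² ≤ ∫_Q |∇f|²` with `⟨f⟩_Q = b⁻³ ∫_Q f`
(from the additive form `local_poincare_cellShift` applied to `f - ⟨f⟩_Q`, whose cell integral
vanishes). [cite: LSSY2005, after (2.50)] -/
theorem poincare_sub_mean (hb : 0 < b) {f : Space → ℂ} (hf : ContDiff ℝ 1 f) (a : Space) :
    ENNReal.ofReal ((Real.pi / b) ^ 2) *
        ∫⁻ x in cellShift b a,
          (‖f x - (b ^ 3)⁻¹ • ∫ y in cellShift b a, f y‖₊ : ℝ≥0∞) ^ 2 ≤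
      ∫⁻ x in cellShift b a, gradSqC f x := by
  set c : ℂ := (b ^ 3)⁻¹ • ∫ y in cellShift b a, f y with hc
  have hg : ContDiff ℝ 1 (fun x => f x - c) := hf.sub contDiff_const
  have h := local_poincare_cellShift hb hg a
  have hgrad : ∀ x, gradSqC (fun y => f y - c) x = gradSqC f x := fun x => gradSqC_sub_const f c x
  have hfi : IntegrableOn (fun x => f (x + a)) (cell b) volume :=
    integrableOn_cell (hf.continuous.comp (continuous_id.add continuous_const))
  have hci : IntegrableOn (fun _ : Space => c) (cell b) volume := by
    refine integrableOn_const ?_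
    rw [volume_cell]
    exact ENNReal.pow_ne_top ENNReal.ofReal_ne_top
  have hint : ∫ x in cellShift b a, (f x - c) = 0 := by
    rw [← setIntegral_cell_comp_add b (fun x => f x - c) a]
    change ∫ x in cell b, ((fun x => f (x + a)) x - (fun _ : Space => c) x) = 0
    rw [integral_sub hfi hci, setIntegral_const, setIntegral_cell_comp_add b f a,
      Measure.real, volume_cell, ENNReal.toReal_pow, ENNReal.toReal_ofReal hb.le, hc, smul_smul,
      mul_inv_cancel₀ (pow_ne_zero 3 hb.ne'), one_smul, sub_self]
  simp only [hgrad, hint, nnnorm_zero, ENNReal.coe_zero, ne_eq, OfNat.ofNat_ne_zero,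
    not_false_eq_true, zero_pow, mul_zero, add_zero] at h
  exact h

/-- **The local mass bound (Neumann bracketing with a potential).** On `Q = a + [0,b)³` with a
measurable potential `w ≤ K ≤ 2π²/(3b²)`, every `C¹` function `f` satisfies
`(∫_Q w) ∫_Q |f|² ≤ 4b³ ∫_Q (|∇f|² + w|f|²)`: with `c = ⟨f⟩_Q`, `D = ∫_Q|f-c|²`,
`|f|² ≤ 2|c|²+2|f-c|²` gives `∫_Q|f|² ≤ 2|c|²b³ + 2D`; `|c|²w ≤ 2w|f|² + 2K|f-c|²` gives
`|c|²∫_Q w ≤ 2∫_Q w|f|² + 2KD`; `∫_Q w ≤ Kb³`; and `(π/b)²D ≤ ∫_Q|∇f|²` (Neumann gap) with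
`6b³K(b/π)² ≤ 4b³`. [cite: LSSY2005, after (2.50)] -/
theorem local_mass_bound (hb : 0 < b) {f : Space → ℂ} (hf : ContDiff ℝ 1 f) (a : Space)
    {w : Space → ℝ≥0∞} (hw : Measurable w) {K : ℝ≥0∞} (hwK : ∀ x, w x ≤ K)
    (hK : K ≤ ENNReal.ofReal (2 * Real.pi ^ 2 / (3 * b ^ 2))) :
    (∫⁻ x in cellShift b a, w x) * ∫⁻ x in cellShift b a, (‖f x‖₊ : ℝ≥0∞) ^ 2 ≤
      ENNReal.ofReal (4 * b ^ 3) *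
        ∫⁻ x in cellShift b a, (gradSqC f x + w x * (‖f x‖₊ : ℝ≥0∞) ^ 2) := by
  set Q := cellShift b a with hQ
  set c : ℂ := (b ^ 3)⁻¹ • ∫ y in Q, f y with hc
  set C : ℝ≥0∞ := (‖c‖₊ : ℝ≥0∞) ^ 2 with hC
  set m : ℝ≥0∞ := ∫⁻ x in Q, (‖f x‖₊ : ℝ≥0∞) ^ 2 with hm
  set T : ℝ≥0∞ := ∫⁻ x in Q, gradSqC f x with hT
  set P : ℝ≥0∞ := ∫⁻ x in Q, w x * (‖f x‖₊ : ℝ≥0∞) ^ 2 with hP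
  set W : ℝ≥0∞ := ∫⁻ x in Q, w x with hW
  set D : ℝ≥0∞ := ∫⁻ x in Q, (‖f x - c‖₊ : ℝ≥0∞) ^ 2 with hD
  set B : ℝ≥0∞ := ENNReal.ofReal b ^ 3 with hB
  have hvol : volume Q = B := volume_cellShift b a
  have hfm : Measurable fun x => ((‖f x‖₊ : ℝ≥0∞) ^ 2) :=
    (hf.continuous.measurable.nnnorm.coe_nnreal_ennreal).pow_const 2
  have hfcm : Measurable fun x => ((‖f x - c‖₊ : ℝ≥0∞) ^ 2) :=
    ((hf.continuous.sub continuous_const).measurable.nnnorm.coe_nnreal_ennreal).pow_const 2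
  -- (1) the Neumann gap
  have h1 : ENNReal.ofReal ((Real.pi / b) ^ 2) * D ≤ T := poincare_sub_mean hb hf a
  -- (2) `m ≤ 2 C B + 2 D`
  have h2 : m ≤ 2 * C * B + 2 * D := by
    calc m ≤ ∫⁻ x in Q, (2 * C + 2 * (‖f x - c‖₊ : ℝ≥0∞) ^ 2) :=
          lintegral_mono fun x => nnnorm_sq_le_two_mul (f x) c
      _ = 2 * C * B + 2 * D := by
          rw [lintegral_add_left measurable_const, setLIntegral_const, hvol,
            lintegral_const_mul _ hfcm]
  -- (3) `C W ≤ 2 P + 2 K D`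
  have h3 : C * W ≤ 2 * P + 2 * (K * D) := by
    calc C * W = ∫⁻ x in Q, C * w x := (lintegral_const_mul C hw).symm
      _ ≤ ∫⁻ x in Q, (2 * (w x * (‖f x‖₊ : ℝ≥0∞) ^ 2) + 2 * (K * (‖f x - c‖₊ : ℝ≥0∞) ^ 2)) := by
          refine lintegral_mono fun x => ?_
          calc C * w x ≤ (2 * (‖f x‖₊ : ℝ≥0∞) ^ 2 + 2 * (‖f x - c‖₊ : ℝ≥0∞) ^ 2) * w x := by
                gcongr
                exact nnnorm_sq_le_two_mul' (f x) c
            _ = 2 * (w x * (‖f x‖₊ : ℝ≥0∞) ^ 2) + 2 * (w x * (‖f x - c‖₊ : ℝ≥0∞) ^ 2) := by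
                ring
            _ ≤ 2 * (w x * (‖f x‖₊ : ℝ≥0∞) ^ 2) + 2 * (K * (‖f x - c‖₊ : ℝ≥0∞) ^ 2) := by
                gcongr
                exact hwK x
      _ = 2 * P + 2 * (K * D) := by
          have hm1 : Measurable fun x => 2 * (w x * (‖f x‖₊ : ℝ≥0∞) ^ 2) :=
            (hw.mul hfm).const_mul 2
          have hm2 : Measurable fun x => w x * (‖f x‖₊ : ℝ≥0∞) ^ 2 := hw.mul hfm
          have hm3 : Measurable fun x => K * (‖f x - c‖₊ : ℝ≥0∞) ^ 2 := hfcm.const_mul K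
          rw [lintegral_add_left hm1, lintegral_const_mul _ hm2, lintegral_const_mul _ hm3,
            lintegral_const_mul _ hfcm]
  -- (4) `W ≤ K B`
  have h4 : W ≤ K * B := by
    calc W ≤ ∫⁻ _ in Q, K := lintegral_mono fun x => hwK x
      _ = K * B := by rw [setLIntegral_const, hvol]
  -- (5) `6 K D ≤ 4 T`
  have h5 : 6 * (K * D) ≤ 4 * T := by
    calc 6 * (K * D) ≤ 6 * (ENNReal.ofReal (2 * Real.pi ^ 2 / (3 * b ^ 2)) * D) := by gcongr
      _ = 4 * (ENNReal.ofReal ((Real.pi / b) ^ 2) * D) := by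
          rw [← mul_assoc, ← mul_assoc,
            show (6 : ℝ≥0∞) = ENNReal.ofReal 6 by norm_num,
            show (4 : ℝ≥0∞) = ENNReal.ofReal 4 by norm_num,
            ← ENNReal.ofReal_mul (by norm_num), ← ENNReal.ofReal_mul (by norm_num)]
          congr 2
          field_simp
          ring
      _ ≤ 4 * T := by gcongr
  -- combine
  have hsum : ∫⁻ x in Q, (gradSqC f x + w x * (‖f x‖₊ : ℝ≥0∞) ^ 2) = T + P :=
    lintegral_add_left (measurable_gradSqC_any f) _
  have h4B : ENNReal.ofReal (4 * b ^ 3) = 4 * B := by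
    rw [ENNReal.ofReal_mul (by norm_num), hB, ENNReal.ofReal_pow hb.le]
    norm_num
  rw [hsum, h4B]
  calc W * m ≤ W * (2 * C * B + 2 * D) := by gcongr
    _ = 2 * B * (C * W) + 2 * (W * D) := by ring
    _ ≤ 2 * B * (2 * P + 2 * (K * D)) + 2 * ((K * B) * D) := by gcongr
    _ = 4 * B * P + B * (6 * (K * D)) := by ring
    _ ≤ 4 * B * P + B * (4 * T) := by gcongr
    _ = 4 * B * (T + P) := by ring

/-- A closed ball of radius `R₀` around a point of the inner cube
`{y | aᵢ + R₀ ≤ yᵢ, yᵢ + R₀ < aᵢ + b}` lies in the cube `a + [0,b)³`. [folklore] -/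
theorem closedBall_subset_cellShift {a y : Space} {R₀ : ℝ}
    (hy : ∀ i, a i + R₀ ≤ y i ∧ y i + R₀ < a i + b) :
    closedBall y R₀ ⊆ cellShift b a := by
  intro x hx
  rw [mem_closedBall, dist_eq_norm] at hx
  rw [mem_cellShift]
  intro i
  have hi : |x i - y i| ≤ R₀ := by
    have h := PiLp.norm_apply_le (x - y) i
    rw [PiLp.sub_apply, Real.norm_eq_abs] at h
    exact h.trans hx
  rw [abs_le] at hi
  obtain ⟨h1, h2⟩ := hy i
  constructor <;> linarith [hi.1, hi.2]

/-- **The potential integral of a scatterer inside the cell is the full one.** If `v` vanishes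
beyond `R₀` and the closed ball `B̄(y, R₀)` lies in `Q`, then
`∫ min(v(|z|), K) dz ≤ ∫_Q min(v(|x - y|), K) dx` (in fact equality). [folklore] -/
theorem lintegral_min_le_setLIntegral {v : ℝ → ℝ≥0∞} {R₀ : ℝ} (hv0 : ∀ r, R₀ < r → v r = 0)
    (K : ℝ≥0∞) {Q : Set Space} {y : Space} (hy : closedBall y R₀ ⊆ Q) :
    ∫⁻ z : Space, min (v ‖z‖) K ≤ ∫⁻ x in Q, min (v ‖x - y‖) K := by
  have hsupp : Function.support (fun x : Space => min (v ‖x - y‖) K) ⊆ closedBall y R₀ := by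
    intro x hx
    rw [mem_closedBall, dist_eq_norm]
    by_contra h
    push Not at h
    exact hx (by simp [hv0 _ h])
  calc ∫⁻ z : Space, min (v ‖z‖) K = ∫⁻ x : Space, min (v ‖x - y‖) K :=
        (lintegral_sub_right_eq_self (fun z : Space => min (v ‖z‖) K) y).symm
    _ = ∫⁻ x in closedBall y R₀, min (v ‖x - y‖) K :=
        (setLIntegral_eq_of_support_subset hsupp).symm
    _ ≤ ∫⁻ x in Q, min (v ‖x - y‖) K := lintegral_mono_set hy

/-- **`W₀(K) = ∫ min(v(|z|), K) dz > 0` for positive scattering length** (`K > 0`): otherwise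
`v(|·|) = 0` a.e. on `ℝ³`, and the trial function `1` in the Lieb–Yngvason variational principle
gives `4πa ≤ ½∫v(|z|)dz = 0`. [cite: LSSY2005, App. C (C.10)] -/
theorem lintegral_min_pos {v : ℝ → ℝ≥0∞} (hv : Measurable v) (ha : 0 < scatteringLength v)
    {K : ℝ≥0∞} (hK : 0 < K) : 0 < ∫⁻ z : Space, min (v ‖z‖) K := by
  rw [pos_iff_ne_zero]
  intro h0
  have hmeas : Measurable fun z : Space => min (v ‖z‖) K :=
    (hv.comp measurable_norm).min measurable_const
  have hae : (fun z : Space => min (v ‖z‖) K) =ᵐ[volume] 0 := (lintegral_eq_zero_iff hmeas).1 h0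
  have hae' : (fun z : Space => 2⁻¹ * v ‖z‖) =ᵐ[volume] fun _ => 0 := by
    filter_upwards [hae] with z hz
    have hz' : min (v ‖z‖) K = 0 := hz
    have hvz : v ‖z‖ = 0 := by
      rcases le_total (v ‖z‖) K with h | h
      · rwa [min_eq_left h] at hz'
      · rw [min_eq_right h] at hz'
        exact absurd hz' hK.ne'
    simp [hvz]
  have h4 := four_pi_mul_scatteringLength_le v
  rw [lintegral_congr_ae hae', lintegral_zero, nonpos_iff_eq_zero, mul_eq_zero] at h4
  rcases h4 with h | h
  · exact (ENNReal.ofReal_ne_zero_iff.mpr (by positivity)) h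
  · exact ha.ne' h

/-- `W₀(K) < ∞` for a finite-range potential and `K < ∞` (it is at most `K |B(0,R₀)|`). [folklore] -/
theorem lintegral_min_lt_top {v : ℝ → ℝ≥0∞} {R₀ : ℝ} (hv0 : ∀ r, R₀ < r → v r = 0)
    {K : ℝ≥0∞} (hK : K ≠ ⊤) : ∫⁻ z : Space, min (v ‖z‖) K < ⊤ := by
  have hsupp : Function.support (fun z : Space => min (v ‖z‖) K) ⊆ closedBall 0 R₀ := by
    intro z hz
    rw [mem_closedBall, dist_zero_right]
    by_contra h
    push Not at h
    exact hz (by simp [hv0 _ h])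
  rw [← setLIntegral_eq_of_support_subset hsupp]
  calc ∫⁻ z in closedBall (0 : Space) R₀, min (v ‖z‖) K
      ≤ ∫⁻ _ in closedBall (0 : Space) R₀, K := lintegral_mono fun _ => min_le_right _ _
    _ = K * volume (closedBall (0 : Space) R₀) := setLIntegral_const _ _
    _ < ⊤ := ENNReal.mul_lt_top hK.lt_top measure_closedBall_lt_top

end Summit.AtomisticToContinuum.BoseEinsteinCondensation.Theorems.FrozenBath

end
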